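import Mathlib
import Literature.Computability.Complexity.CliqueTestGraphs
import Summits.PneNP.PneNP.Theorems.ConvexRankGatesConvexGateBlindJuntaBlind

/-!
# PneNP / ConvexRankGates — `ConvexGateBlind`: the rainbow pseudo-distribution as an honest signed measure (SA form)

Helpers (`--supports stmt-PneNP-10680`), a corollary file of `…JuntaBlind.lean`. The one-clump functional `rbL` of
`…RainbowFunctional.lean` is integration against a SIGNED MEASURE on the `(K+1)`-sets,
`ψ_h(Q) := rbL(𝟙[· = Q])` (`rbMeasure`; `rbL_eq_sum_rbMeasure`). Normalised, it is a degree-`t` Sherali–Adams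
pseudo-distribution for the infeasible system "a `(K+1)`-set meeting each of the `K` colour classes at most once"
(`rainbow_pseudodistribution`, registered stub): total mass `1`, it integrates the colouring column
`Q ↦ cdist Q (colorVec h) = mono_h(Q)` to `0`, every inclusion indicator `𝟙[T ⊆ ·]` with `#T ≤ K` to
`[T rainbow]·(K+1)/((K+1-#T) n^{#T}) ≥ 0`, and every local pattern `𝟙[· ∩ S = P]` with `#S ≤ t` (`2t ≤ K`) to a
non-negative number. In the test-cover language of `…TestCover.lean` (p89553): `ψ_h` is a VALID TEST for the colouring
column that NO planted attack `𝟙[T ⊆ ·]` (`#T ≤ K`) and NO non-negative `t`-junta attack catches — the counting method's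
cap on colouring rows can only come from global attacks (atoms on rare types, windows). [new]
-/

namespace Summit.PneNP.PneNP.Theorems

open Finset Literature.Computability.Complexity
open Summit.PneNP.PneNP.Cruxes.ConvexGateBlind.StrictRankConicCover (cdist)

noncomputable section

variable {m K : ℕ}

/-- The rainbow pseudo-distribution as a signed measure on vertex sets: `ψ_h(Q) = L(𝟙[· = Q])` (unnormalised). -/
def rbMeasure (h : Fin m → Fin K) (n : ℕ) (Q : Finset (Fin m)) : ℝ :=
  rbL h n fun Q' => if Q' = Q then 1 else 0

/-- **`L` is integration against `ψ_h`** over the `(K+1)`-sets. -/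
theorem rbL_eq_sum_rbMeasure (h : Fin m → Fin K) (n : ℕ) (f : Finset (Fin m) → ℝ) :
    rbL h n f = ∑ Q ∈ (univ : Finset (Fin m)).powersetCard (K + 1), rbMeasure h n Q * f Q := by
  classical
  have hexp : ∀ Q' : Finset (Fin m), Q'.card = K + 1 →
      f Q' = ∑ Q ∈ (univ : Finset (Fin m)).powersetCard (K + 1), f Q * (if Q' = Q then (1 : ℝ) else 0) := by
    intro Q' hQ'
    rw [Finset.sum_eq_single_of_mem Q' (mem_powersetCard.2 ⟨subset_univ _, hQ'⟩)]
    · simp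
    · intro Q _ hQ
      rw [if_neg (Ne.symm hQ), mul_zero]
  rw [rbL_congr h n hexp, rbL_sum]
  refine Finset.sum_congr rfl fun Q _ => ?_
  rw [rbL_smul, rbMeasure, mul_comm]

/-- **The rainbow pseudo-distribution (Sherali–Adams form).** For a colouring `h : Fin m → Fin K` with `K ≥ 2` classes of
common size `n ≥ K + 1` and `2t ≤ K` there is a signed measure `ψ` on the vertex sets with
(i) `∑_{#Q = K+1} ψ(Q) = 1`; (ii) `∑_Q ψ(Q) · cdist Q (colorVec h) = 0` (it "sees no monochromatic pair");
(iii) `∑_Q ψ(Q) 𝟙[T ⊆ Q] = [T rainbow] (K+1) / ((K+1-#T) n^{#T}) ≥ 0` for `#T ≤ K` (no planted attack catches it);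
(iv) `∑_Q ψ(Q) 𝟙[Q ∩ S = P] ≥ 0` for `P ⊆ S`, `#S ≤ t` (all local laws are genuine sub-probabilities). [new] -/
theorem rainbow_pseudodistribution : ∀ {m K n t : ℕ} (h : Fin m → Fin K), (∀ c, (cls h c).card = n) → 2 ≤ K → K + 1 ≤ n → 2 * t ≤ K → ∃ ψ : Finset (Fin m) → ℝ, (∑ Q ∈ (Finset.univ : Finset (Fin m)).powersetCard (K + 1), ψ Q = 1) ∧ (∑ Q ∈ (Finset.univ : Finset (Fin m)).powersetCard (K + 1), ψ Q * cdist Q (colorVec h) = 0) ∧ (∀ T : Finset (Fin m), T.card ≤ K → (∑ Q ∈ (Finset.univ : Finset (Fin m)).powersetCard (K + 1), ψ Q * (if T ⊆ Q then (1 : ℝ) else 0)) = if Set.InjOn h ↑T then ((K : ℝ) + 1) / (((K : ℝ) + 1 - T.card) * (n : ℝ) ^ T.card) else 0) ∧ (∀ S P : Finset (Fin m), P ⊆ S → S.card ≤ t → 0 ≤ ∑ Q ∈ (Finset.univ : Finset (Fin m)).powersetCard (K + 1), ψ Q * (if Q ∩ S = P then (1 : ℝ) else 0)) := by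
  intro m K n t h hn hK hKn ht
  classical
  -- normalising constant `Z = L(1) = K n^K / (K+1) > 0`
  set Z : ℝ := (K : ℝ) * (n : ℝ) ^ K / ((K : ℝ) + 1) with hZ
  have hKpos : (0 : ℝ) < K := by exact_mod_cast (show 0 < K by omega)
  have hnpos : (0 : ℝ) < n := by exact_mod_cast (show 0 < n by omega)
  have hZpos : 0 < Z := by rw [hZ]; positivity
  have hZne : Z ≠ 0 := hZpos.ne'
  refine ⟨fun Q => rbMeasure h n Q / Z, ?_, ?_, ?_, ?_⟩
  · -- (i) total mass
    have h1 := rbL_one h hn hKn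
    rw [rbL_eq_sum_rbMeasure] at h1
    simp only [mul_one] at h1
    rw [← Finset.sum_div, h1, hZ, div_self hZne]
  · -- (ii) the colouring column integrates to zero
    have h2 := rbL_cdist_colorVec h hn hK hKn
    rw [rbL_eq_sum_rbMeasure] at h2
    have : ∑ Q ∈ (univ : Finset (Fin m)).powersetCard (K + 1), rbMeasure h n Q / Z * cdist Q (colorVec h) =
        (∑ Q ∈ (univ : Finset (Fin m)).powersetCard (K + 1), rbMeasure h n Q * cdist Q (colorVec h)) / Z := by
      rw [Finset.sum_div]
      refine Finset.sum_congr rfl fun Q _ => ?_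
      ring
    rw [this, h2, zero_div]
  · -- (iii) inclusion numbers
    intro T hT
    have h3 := rbL_indicator h hn hKn T hT
    rw [rbL_eq_sum_rbMeasure] at h3
    have : ∑ Q ∈ (univ : Finset (Fin m)).powersetCard (K + 1), rbMeasure h n Q / Z * (if T ⊆ Q then (1 : ℝ) else 0) =
        (∑ Q ∈ (univ : Finset (Fin m)).powersetCard (K + 1), rbMeasure h n Q * (if T ⊆ Q then (1 : ℝ) else 0)) / Z := by
      rw [Finset.sum_div]
      refine Finset.sum_congr rfl fun Q _ => ?_
      ring
    rw [this, h3]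
    split_ifs with hinj
    · rw [hZ]
      have hden : (K : ℝ) + 1 - T.card ≠ 0 := by
        have : (T.card : ℝ) ≤ K := by exact_mod_cast hT
        linarith
      have hpow : (n : ℝ) ^ K = (n : ℝ) ^ (K - T.card) * (n : ℝ) ^ T.card := by
        rw [← pow_add]; congr 1; omega
      rw [hpow]
      field_simp
    · simp
  · -- (iv) local laws
    intro S P hPS hS
    have h4 := rbL_localLaw_nonneg h hn hK hKn ht hPS hS
    rw [rbL_eq_sum_rbMeasure] at h4
    have : ∑ Q ∈ (univ : Finset (Fin m)).powersetCard (K + 1), rbMeasure h n Q / Z * (if Q ∩ S = P then (1 : ℝ) else 0) =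
        (∑ Q ∈ (univ : Finset (Fin m)).powersetCard (K + 1), rbMeasure h n Q * (if Q ∩ S = P then (1 : ℝ) else 0)) / Z := by
      rw [Finset.sum_div]
      refine Finset.sum_congr rfl fun Q _ => ?_
      ring
    rw [this]
    exact div_nonneg h4 hZpos.le

end

end Summit.PneNP.PneNP.Theorems
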